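import Summits.QuantumFields.YangMills.Theorems.ParabolicTrajectoryLatticeGapOnTrajectorySlabClusteringFar
import HarnessLib

/-!
# Crux `LatticeGapOnTrajectory` (stmt-QuantumFields-10523), line `orbit-kantorovich-finite-size`:
# stub `stub_slabClustering` — slab clustering in cluster-expansion format on the scheme's torus

From the orbit–Kantorovich windows along the scheme (with the polynomial clause
`|β_k| α_k ≤ K₀ a_k^{−p₀}`) and the landed engine package (`KREngine`, `TorusFramesExist`,
`SpecificationTower`, `WilsonTorusDLR`): eventually in `k`, for every bounded measurable SLAB
observable `X` (links based at lattice times `1 … w`) on the torus of side `2L_k+1` and every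
separation `N` with `N + 2w ≤ L_k`,
`‖osCorr μ_k Θ₀ τ_N X X‖ ≤ K (a_k⁻¹ (w+1)(L_k+1))^p B² e^{−Δ a_k N}`, `Δ = κ(n₀,γ₀,1)/t`.

Structure of the proof (helper files `…SlabClusteringKernels`, `…TorusKernels`, `…Geometry`, `…OS`,
`…Far`): the reflected autocorrelation is the complex covariance of `conj X∘Θ₀` (links at times
`≥ 2L−w`) and `X∘τ_N` (times `N+1…N+w`), i.e. four real covariances of slab observables; on the torus
read through uniform frames of scale `b_k = t M^{n_k}` the two slabs lie in two label regions whose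
`torusYM`-averages have FINITE RANGE (adjacent label layers) and are TV-LIPSCHITZ in the capped orbit
weight (`δ = 2B(1 + 2e²|β|α·7680 b⁴)`, polynomial in `a_k⁻¹` by the `|β|α` clause); the two-region
tower identity and `KREngine` give `C₀((K+1)⁴δ)² e^{−κ(N/b−3)}` (`norm_osCorr_le_far`).

* §2 here: the near case `N < 3b` (trivial bound `2B²`, `norm_osCorr_le_near`), the far case in
  polynomial form (`norm_osCorr_le_far_poly`: `(K+1)⁴ ≤ 16X⁴`, `δ ≤ 2Bc₁X^{p₀+4}`,
  `e^{−κ(N/b−3)} ≤ e^{4κ}e^{−(κ/t)aN}`, `X = a⁻¹(w+1)(L+1)`), and the stub (eventualities in `k`: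
  window package at `s = 0`, polynomial clause, `a_k ≤ 1`, `(2n₀+7) b_k ≤ L_k`).
-/

namespace Summit.QuantumFields.YangMills.Cruxes.LatticeGapOnTrajectory.OrbitKantorovichFiniteSize

open scoped BigOperators ComplexConjugate ENNReal ProbabilityTheory
open Filter MeasureTheory
open Literature.Probability.LatticeModels (Specification IsSpecification IsGibbsMeasure glueWith)
open Literature.MathematicalPhysics.QuantumLattice
open Literature.MathematicalPhysics.QuantumFieldTheory

noncomputable section

namespace SlabClustering

/-! ### Near case and polynomial bookkeeping at one scale -/

section Scale

variable {G : Type} [Group G] [TopologicalSpace G] [IsTopologicalGroup G] [CompactSpace G]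
  [MeasurableSpace G] [BorelSpace G] (r : LatticeRep G)

/-- **Near case** (`N < 3b`, `b = t/a`): the trivial bound `‖osCorr‖ ≤ 2B²` and
`1 ≤ e^{3κ} e^{−(κ/t) a N}`. -/
theorem norm_osCorr_le_near (β : ℝ) {κ t a : ℝ} (hκ : 0 ≤ κ) (ht : 0 < t) (ha : 0 < a)
    {Lk Nsep b : ℕ} (hbR : (b : ℝ) = t * a⁻¹) (hnear : Nsep < 3 * b)
    {X : GaugeConfig 4 (2 * Lk + 1) G → ℂ} {B : ℝ} (hXb : ∀ U, ‖X U‖ ≤ B) :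
    ‖osCorr (wilsonMeasure (d := 4) (L := 2 * Lk + 1) r.ρ β) GaugeConfig.negReflect
        (torusTimeShift (2 * Lk + 1) Nsep) X X‖ ≤
      2 * Real.exp (3 * κ) * B ^ 2 * Real.exp (-(κ / t) * a * Nsep) := by
  have h1 := norm_osCorr_negReflect_le_two_mul_sq r.ρ r.continuous β Nsep hXb
  have hab : a * b = t := by rw [hbR]; field_simp
  have h2 : 1 ≤ Real.exp (3 * κ) * Real.exp (-(κ / t) * a * Nsep) := by
    rw [← Real.exp_add]
    apply Real.one_le_exp
    have h3 : a * Nsep ≤ 3 * t := by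
      have : (Nsep : ℝ) ≤ 3 * b := by exact_mod_cast hnear.le
      calc a * Nsep ≤ a * (3 * b) := by gcongr
        _ = 3 * t := by rw [← hab]; ring
    have h4 : κ / t * (a * Nsep) ≤ κ / t * (3 * t) := mul_le_mul_of_nonneg_left h3 (by positivity)
    have h5 : κ / t * (3 * t) = 3 * κ := by field_simp
    have h6 : -(κ / t) * a * Nsep = -(κ / t * (a * Nsep)) := by ring
    rw [h6]
    linarith
  calc _ ≤ 2 * B ^ 2 := h1
    _ ≤ 2 * B ^ 2 * (Real.exp (3 * κ) * Real.exp (-(κ / t) * a * Nsep)) :=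
        le_mul_of_one_le_right (by positivity) h2
    _ = _ := by ring

/-- **Far case in polynomial form** (`3b ≤ N`, `b = t/a`, `a ≤ 1`, `|β| α ≤ K₀ a^{−p₀}`): from
`norm_osCorr_le_far` with `(K+1)⁴ ≤ 16 X⁴`, `δ ≤ 2B c₁ X^{p₀+4}` (`X = a⁻¹(w+1)(L+1) ≥ 1`,
`c₁ = 1 + 2e²|K₀|·7680 t⁴`) and `e^{−κ(N/b − 3)} ≤ e^{4κ} e^{−(κ/t) a N}`:
`‖osCorr μ Θ₀ τ_N X X‖ ≤ 4096 C₀ c₁² e^{4κ} X^{2(p₀+8)} B² e^{−(κ/t) a N}`. -/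
theorem norm_osCorr_le_far_poly (hT : SpecificationTower) {n₀ : ℕ} {γ₀ κ C₀ : ℝ} (hκ : 0 ≤ κ)
    (hC₀ : 0 ≤ C₀)
    (hEng : ∀ (μ : Fin 4 → ℕ) (V S : Type) [Fintype V] [MeasurableSpace S]
      (cell : V → CoarseIdx μ) (w : CoarseIdx μ → (V → S) → (V → S) → ℝ)
      (γ : Specification V S) (k : CoarseIdx μ → CoarseIdx μ → CoarseIdx μ → ℝ),
      (∀ i, 2 * n₀ + 3 ≤ μ i + 1) → IsSpecification γ → IsKRWindow cell w γ 1 n₀ γ₀ k →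
      ∀ ν : Measure (V → S), IsGibbsMeasure γ ν →
      ∀ (f g : (V → S) → ℝ) (Δf Δg : Finset (CoarseIdx μ)) (δf δg : CoarseIdx μ → ℝ) (D : ℕ),
        Measurable f → Measurable g → (∃ B, ∀ σ, |f σ| ≤ B) → (∃ B, ∀ σ, |g σ| ≤ B) →
        DependsOn f {v | cell v ∈ Δf} → DependsOn g {v | cell v ∈ Δg} →
        IsCellLipBound cell w f δf → IsCellLipBound cell w g δg →
        (∀ x ∈ Δf, ∀ y ∈ Δg, D ≤ cdist x y) →
          |cov[f, g; ν]| ≤ C₀ * (∑ x ∈ Δf, δf x) * (∑ y ∈ Δg, δg y) * Real.exp (-(κ * D)))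
    (β α : ℝ) (hα : 0 < α) {t p₀ : ℕ} {K₀ a : ℝ} (ht : 1 ≤ t) (ha0 : 0 < a) (ha1 : a ≤ 1)
    {Lk b K w Nsep : ℕ} (hbR : (b : ℝ) = t * a⁻¹) (hb : 0 < b) (hK : K + 1 = (2 * Lk + 1) / b)
    (hbL : 4 * b ≤ Lk) (hNw : Nsep + 2 * w ≤ Lk) (hfar : 3 * b ≤ Nsep) (hn₀ : 2 * n₀ + 3 ≤ K + 1)
    (hγ : IsSpecification (torusYM r.ρ β (2 * Lk + 1)))
    (hGibbs : IsGibbsMeasure (torusYM r.ρ β (2 * Lk + 1)) (wilsonMeasure (d := 4) (L := 2 * Lk + 1) r.ρ β))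
    (hphys : ∀ (μ : Fin 4 → ℕ) (q : (i : Fin 4) → ZMod (2 * Lk + 1) → ZMod (μ i + 1)),
        (∀ i, 2 * n₀ + 3 ≤ μ i + 1) → (∀ i, IsTorusFrame (2 * Lk + 1) b (q i)) →
          ∃ kp : CoarseIdx μ → CoarseIdx μ → CoarseIdx μ → ℝ,
            IsKRWindow (cellOf q) (orbitWeight r α q) (torusYM r.ρ β (2 * Lk + 1)) 1 n₀ γ₀ kp)
    (hP : |β| * α ≤ K₀ * a⁻¹ ^ p₀)
    {X : GaugeConfig 4 (2 * Lk + 1) G → ℂ} {B : ℝ} (hXm : Measurable X) (hXb : ∀ U, ‖X U‖ ≤ B)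
    (hXdep : DependsOn X {e : Edge 4 (2 * Lk + 1) | 1 ≤ (e.1 0).val ∧ (e.1 0).val ≤ w}) :
    ‖osCorr (wilsonMeasure (d := 4) (L := 2 * Lk + 1) r.ρ β) GaugeConfig.negReflect
        (torusTimeShift (2 * Lk + 1) Nsep) X X‖ ≤
      4096 * C₀ * (1 + 2 * Real.exp 2 * |K₀| * (7680 * (t : ℝ) ^ 4)) ^ 2 * Real.exp (4 * κ) *
        (a⁻¹ * ((w : ℝ) + 1) * ((Lk : ℝ) + 1)) ^ ((p₀ + 8) * 2) * B ^ 2 *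
          Real.exp (-(κ / t) * a * Nsep) := by
  have h1 := norm_osCorr_le_far r hT hC₀ hEng β α hα hb hK hbL hNw hfar hn₀ hγ hGibbs hphys hXm hXb hXdep
  have ht0 : (0 : ℝ) < t := by exact_mod_cast ht
  have hb0R : (0 : ℝ) < b := by exact_mod_cast hb
  have hB : 0 ≤ B := (norm_nonneg _).trans (hXb fun _ => 1)
  -- the polynomial `X ≥ 1`
  obtain ⟨Xp, hXp⟩ : ∃ Xp : ℝ, Xp = a⁻¹ * ((w : ℝ) + 1) * ((Lk : ℝ) + 1) := ⟨_, rfl⟩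
  obtain ⟨c₁, hc₁⟩ : ∃ c₁ : ℝ, c₁ = 1 + 2 * Real.exp 2 * |K₀| * (7680 * (t : ℝ) ^ 4) := ⟨_, rfl⟩
  rw [← hXp, ← hc₁, pow_mul]
  have ha1' : 1 ≤ a⁻¹ := (one_le_inv₀ ha0).2 ha1
  have hw1 : (1 : ℝ) ≤ (w : ℝ) + 1 := by have := Nat.cast_nonneg (α := ℝ) w; linarith
  have hL1 : (1 : ℝ) ≤ (Lk : ℝ) + 1 := by have := Nat.cast_nonneg (α := ℝ) Lk; linarith
  have hXa : a⁻¹ ≤ Xp := by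
    rw [hXp]
    calc a⁻¹ = a⁻¹ * 1 * 1 := by ring
      _ ≤ a⁻¹ * ((w : ℝ) + 1) * ((Lk : ℝ) + 1) := by gcongr
  have hXL : (Lk : ℝ) + 1 ≤ Xp := by
    rw [hXp]
    calc (Lk : ℝ) + 1 = 1 * 1 * ((Lk : ℝ) + 1) := by ring
      _ ≤ a⁻¹ * ((w : ℝ) + 1) * ((Lk : ℝ) + 1) := by gcongr
  have hX1 : 1 ≤ Xp := ha1'.trans hXa
  -- `(K+1)⁴ ≤ 16 X⁴`
  have hK1 : ((K : ℝ) + 1) ≤ 2 * Xp := by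
    have h3 : K + 1 ≤ 2 * Lk + 1 := by rw [hK]; exact Nat.div_le_self _ _
    have h4 : ((K : ℝ) + 1) ≤ 2 * Lk + 1 := by exact_mod_cast h3
    linarith [hXL]
  have hK4 : ((K : ℝ) + 1) ^ 4 ≤ 16 * Xp ^ 4 := by
    calc ((K : ℝ) + 1) ^ 4 ≤ (2 * Xp) ^ 4 := pow_le_pow_left₀ (by positivity) hK1 4
      _ = 16 * Xp ^ 4 := by ring
  -- `δ ≤ 2B c₁ X^{p₀+4}`
  have hβα : |β| * α ≤ |K₀| * Xp ^ p₀ :=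
    hP.trans ((mul_le_mul_of_nonneg_right (le_abs_self _) (by positivity)).trans
      (mul_le_mul_of_nonneg_left (pow_le_pow_left₀ (by positivity) hXa p₀) (abs_nonneg _)))
  have hb4 : (b : ℝ) ^ 4 ≤ (t : ℝ) ^ 4 * Xp ^ 4 := by
    rw [hbR, mul_pow]
    gcongr
  have hδ : 2 * B * (1 + 2 * Real.exp 2 * |β| * α * (7680 * (b : ℝ) ^ 4)) ≤
      2 * B * c₁ * Xp ^ (p₀ + 4) := by
    have h3 : 2 * Real.exp 2 * |β| * α * (7680 * (b : ℝ) ^ 4) ≤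
        2 * Real.exp 2 * (|K₀| * Xp ^ p₀) * (7680 * ((t : ℝ) ^ 4 * Xp ^ 4)) := by
      have h4 : 2 * Real.exp 2 * |β| * α * (7680 * (b : ℝ) ^ 4) =
          2 * Real.exp 2 * (|β| * α) * (7680 * (b : ℝ) ^ 4) := by ring
      rw [h4]
      gcongr
    have hXpow : (1 : ℝ) ≤ Xp ^ (p₀ + 4) := one_le_pow₀ hX1
    have hpa : Xp ^ p₀ * Xp ^ 4 = Xp ^ (p₀ + 4) := (pow_add _ _ _).symm
    calc 2 * B * (1 + 2 * Real.exp 2 * |β| * α * (7680 * (b : ℝ) ^ 4))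
        ≤ 2 * B * (1 + 2 * Real.exp 2 * (|K₀| * Xp ^ p₀) * (7680 * ((t : ℝ) ^ 4 * Xp ^ 4))) := by
          gcongr
      _ = 2 * B * (1 + (2 * Real.exp 2 * |K₀| * (7680 * (t : ℝ) ^ 4)) * (Xp ^ p₀ * Xp ^ 4)) := by
          ring
      _ ≤ 2 * B * (Xp ^ (p₀ + 4) + (2 * Real.exp 2 * |K₀| * (7680 * (t : ℝ) ^ 4)) * Xp ^ (p₀ + 4)) := by
          rw [hpa]
          gcongr
      _ = 2 * B * c₁ * Xp ^ (p₀ + 4) := by rw [hc₁]; ring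
  -- `A ≤ 32 c₁ B Y`, `Y = X^{p₀+8}`
  obtain ⟨Y, hY⟩ : ∃ Y : ℝ, Y = Xp ^ (p₀ + 8) := ⟨_, rfl⟩
  rw [← hY]
  have hY0 : 0 ≤ Y := by rw [hY]; positivity
  have h48 : Xp ^ 4 * Xp ^ (p₀ + 4) = Y := by
    rw [hY, ← pow_add, show 4 + (p₀ + 4) = p₀ + 8 by omega]
  obtain ⟨A, hA⟩ : ∃ A : ℝ, A = ((K : ℝ) + 1) ^ 4 *
      (2 * B * (1 + 2 * Real.exp 2 * |β| * α * (7680 * (b : ℝ) ^ 4))) := ⟨_, rfl⟩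
  obtain ⟨E, hE⟩ : ∃ E : ℝ, E = Real.exp (-(κ * ((Nsep / b - 3 : ℕ) : ℝ))) := ⟨_, rfl⟩
  rw [← hA, ← hE] at h1
  have hA0 : 0 ≤ A := by rw [hA]; positivity
  have hAY : A ≤ 32 * c₁ * B * Y := by
    rw [hA]
    calc _ ≤ 16 * Xp ^ 4 * (2 * B * c₁ * Xp ^ (p₀ + 4)) := mul_le_mul hK4 hδ (by positivity) (by positivity)
      _ = 32 * c₁ * B * (Xp ^ 4 * Xp ^ (p₀ + 4)) := by ring
      _ = 32 * c₁ * B * Y := by rw [h48]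
  -- `e^{−κ(N/b − 3)} ≤ e^{4κ} e^{−(κ/t) a N}`
  have hEE' : E ≤ Real.exp (4 * κ) * Real.exp (-(κ / t) * a * Nsep) := by
    rw [hE, ← Real.exp_add, Real.exp_le_exp]
    have hD : (Nsep : ℝ) * a / t - 4 ≤ ((Nsep / b - 3 : ℕ) : ℝ) := by
      have h3 : (Nsep : ℝ) / b - 1 ≤ ((Nsep / b : ℕ) : ℝ) := by
        have h4 : Nsep < Nsep / b * b + b := Nat.lt_div_mul_add hb
        have h5 : (Nsep : ℝ) < ((Nsep / b : ℕ) : ℝ) * b + b := by exact_mod_cast h4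
        rw [sub_le_iff_le_add, div_le_iff₀ hb0R]
        linarith
      have h6 : (3 : ℕ) ≤ Nsep / b := (Nat.le_div_iff_mul_le hb).2 hfar
      have h7 : ((Nsep / b - 3 : ℕ) : ℝ) = ((Nsep / b : ℕ) : ℝ) - 3 := by
        rw [Nat.cast_sub h6]; norm_num
      have h8 : (Nsep : ℝ) / b = Nsep * a / t := by
        rw [hbR]; field_simp
      linarith
    have h9 := mul_le_mul_of_nonneg_left hD hκ
    have h10 : -(κ / t) * a * Nsep = -(κ * (Nsep * a / t)) := by ring
    rw [h10]
    linarith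
  have step : C₀ * A ^ 2 * E ≤ C₀ * (32 * c₁ * B * Y) ^ 2 * (Real.exp (4 * κ) * Real.exp (-(κ / t) * a * Nsep)) :=
    mul_le_mul (mul_le_mul_of_nonneg_left (pow_le_pow_left₀ hA0 hAY 2) hC₀) hEE'
      (by rw [hE]; positivity) (by positivity)
  calc _ ≤ 4 * (C₀ * A ^ 2 * E) := h1
    _ ≤ 4 * (C₀ * (32 * c₁ * B * Y) ^ 2 * (Real.exp (4 * κ) * Real.exp (-(κ / t) * a * Nsep))) := by
        linarith [step]
    _ = _ := by ring

end Scale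

end SlabClustering

open SlabClustering in
/-- **stub_slabClustering** — slab clustering in cluster-expansion format on the scheme's own torus
(line `orbit-kantorovich-finite-size`, reshape 4b; G-blind plumbing, `RoughCentreBound` unused).
From the orbit–Kantorovich windows along the scheme with the polynomial clause
`|β_k| α_k ≤ K₀ a_k^{−p₀}` and the engine package: with `(κ, C₀) = KREngine(n₀, γ₀, 1)`,
`Δ = κ/t`, `p = 2(p₀ + 8)`, `K = 4096 C₀ c₁² e^{4κ} + 2e^{3κ}` (`c₁ = 1 + 2e²|K₀|·7680 t⁴`),
eventually in `k` (window package at `s = 0`, polynomial clause, `a_k ≤ 1`,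
`(2n₀+7) b_k ≤ L_k` for `b_k = t M^{n_k} = t/a_k`), for every bounded measurable slab observable `X`
of lattice times `1 … w` on the torus of side `2L_k+1` and `N + 2w ≤ L_k`: near case `N < 3b_k` by
`norm_osCorr_le_near`, far case by `norm_osCorr_le_far_poly` on the torus of side `2L_k + 1` with
uniform frames of scale `b_k` (`K + 1 = (2L_k+1)/b_k ≥ 2n₀ + 3` cells per axis). -/
theorem stub_slabClustering :
    ∀ (G : Type) [Group G] [TopologicalSpace G] [IsTopologicalGroup G] [CompactSpace G]
      [MeasurableSpace G] [BorelSpace G] (r : LatticeRep G) (M : ℕ) (sch : SpeciesScheme (YMSpecies G))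
      (n : ℕ → ℕ), 2 ≤ M → (∀ k, sch.a k = ((M : ℝ) ^ n k)⁻¹) →
      KREngine → TorusFramesExist → SpecificationTower → WilsonTorusDLR r →
      (∃ (t n₀ : ℕ) (γ₀ : ℝ) (α : ℕ → ℝ) (K : ℕ → ℝ), 1 ≤ t ∧ 0 ≤ γ₀ ∧ γ₀ < 1 ∧ (∀ k, 0 < α k) ∧
          (∃ (p₀ : ℕ) (K₀ : ℝ), ∀ᶠ k in atTop, |sch.β k| * α k ≤ K₀ * ((sch.a k)⁻¹) ^ p₀) ∧
          ∀ s : ℕ, ∀ᶠ k in atTop, ∀ S : ℕ, sch.L k ≤ S →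
            ∀ (μ : Fin 4 → ℕ) (q : (i : Fin 4) → ZMod (2 * S + 1) → ZMod (μ i + 1)),
              (∀ i, 2 * n₀ + 3 ≤ μ i + 1) → (∀ i, IsTorusFrame (2 * S + 1) (t * M ^ n k) (q i)) →
                (∃ kp : CoarseIdx μ → CoarseIdx μ → CoarseIdx μ → ℝ,
                    IsKRWindow (cellOf q) (orbitWeight r (α k) q) (torusYM r.ρ (sch.β k) (2 * S + 1)) 1 n₀ γ₀ kp) ∧
                RoughCentreBound r (sch.β k) (2 * S + 1) q (α k) n₀ s (K s)) →
        ∃ Δ : ℝ, 0 < Δ ∧ ∃ (p : ℕ) (K : ℝ), 0 ≤ K ∧ ∀ᶠ k in atTop,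
          ∀ (w N : ℕ) (X : GaugeConfig 4 (sch.side k) G → ℂ) (B : ℝ), Measurable X → (∀ U, ‖X U‖ ≤ B) →
            DependsOn X {e : Edge 4 (sch.side k) | 1 ≤ (e.1 0).val ∧ (e.1 0).val ≤ w} →
            N + 2 * w ≤ sch.L k →
              ‖osCorr (wilsonMeasure r.ρ (sch.β k)) GaugeConfig.negReflect (torusTimeShift (sch.side k) N) X X‖ ≤
                K * ((sch.a k)⁻¹ * ((w : ℝ) + 1) * ((sch.L k : ℝ) + 1)) ^ p * B ^ 2 *
                  Real.exp (-Δ * sch.a k * N) := by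
  intro G _ _ _ _ _ _ r M sch n hM hshape hE _hTF hT hDLR hW
  obtain ⟨t, n₀, γ₀, α, Kf, ht, hγ₀, hγ₀1, hα, ⟨p₀, K₀, hP⟩, hWs⟩ := hW
  obtain ⟨κ, C₀, hκ, hC₀, hEng⟩ := hE n₀ γ₀ 1 hγ₀ hγ₀1 zero_le_one
  have ht0 : (0 : ℝ) < t := by exact_mod_cast ht
  refine ⟨κ / t, div_pos hκ ht0, (p₀ + 8) * 2,
    4096 * C₀ * (1 + 2 * Real.exp 2 * |K₀| * (7680 * (t : ℝ) ^ 4)) ^ 2 * Real.exp (4 * κ) +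
      2 * Real.exp (3 * κ), by positivity, ?_⟩
  have E1 : ∀ᶠ k in atTop, sch.a k ≤ 1 :=
    (sch.tendsto_a.eventually (gt_mem_nhds one_pos)).mono fun k hk => le_of_lt hk
  have E2 : ∀ᶠ k in atTop, (((2 * n₀ + 7) * t : ℕ) : ℝ) ≤ sch.a k * sch.L k :=
    sch.tendsto_L.eventually_ge_atTop _
  filter_upwards [hWs 0, hP, E1, E2] with k hk hPk ha1 hk2
  intro w Nsep X B hXm hXb hXdep hNw
  -- the scales at step `k`
  have ha0 : 0 < sch.a k := sch.a_pos k
  have hMn : ((M : ℝ) ^ n k) = (sch.a k)⁻¹ := by rw [hshape k, inv_inv]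
  have hbR : ((t * M ^ n k : ℕ) : ℝ) = t * (sch.a k)⁻¹ := by push_cast; rw [hMn]
  have hb0 : 0 < t * M ^ n k := Nat.mul_pos ht (Nat.pow_pos (by omega))
  have hL : (2 * n₀ + 7) * (t * M ^ n k) ≤ sch.L k := by
    have h1 : (((2 * n₀ + 7) * (t * M ^ n k) : ℕ) : ℝ) ≤ sch.L k := by
      have h2 : (((2 * n₀ + 7) * t : ℕ) : ℝ) * (sch.a k)⁻¹ ≤ sch.L k := by
        rw [← div_eq_mul_inv, div_le_iff₀ ha0]
        simpa [mul_comm] using hk2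
      have h3 : (((2 * n₀ + 7) * (t * M ^ n k) : ℕ) : ℝ) = (((2 * n₀ + 7) * t : ℕ) : ℝ) * (sch.a k)⁻¹ := by
        push_cast
        rw [hMn]
        ring
      rw [h3]
      exact h2
    exact_mod_cast h1
  have hbL : 4 * (t * M ^ n k) ≤ sch.L k := le_trans (Nat.mul_le_mul_right _ (by omega)) hL
  have hdiv : 1 ≤ (2 * sch.L k + 1) / (t * M ^ n k) := (Nat.le_div_iff_mul_le hb0).2 (by omega)
  have hK : (2 * sch.L k + 1) / (t * M ^ n k) - 1 + 1 = (2 * sch.L k + 1) / (t * M ^ n k) := by omega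
  have hn₀K : 2 * n₀ + 3 ≤ (2 * sch.L k + 1) / (t * M ^ n k) - 1 + 1 := by
    rw [hK, Nat.le_div_iff_mul_le hb0]
    nlinarith [hL]
  obtain ⟨hγ, hGibbs⟩ := hDLR (sch.β k) (2 * sch.L k + 1)
  have hphys : ∀ (μ : Fin 4 → ℕ) (q : (i : Fin 4) → ZMod (2 * sch.L k + 1) → ZMod (μ i + 1)),
      (∀ i, 2 * n₀ + 3 ≤ μ i + 1) → (∀ i, IsTorusFrame (2 * sch.L k + 1) (t * M ^ n k) (q i)) →
        ∃ kp : CoarseIdx μ → CoarseIdx μ → CoarseIdx μ → ℝ,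
          IsKRWindow (cellOf q) (orbitWeight r (α k) q) (torusYM r.ρ (sch.β k) (2 * sch.L k + 1)) 1 n₀ γ₀ kp :=
    fun μ q hμ hq => (hk (sch.L k) le_rfl μ q hμ hq).1
  -- `X ≥ 1`
  have hX1 : 1 ≤ (sch.a k)⁻¹ * ((w : ℝ) + 1) * ((sch.L k : ℝ) + 1) := by
    have ha1' : 1 ≤ (sch.a k)⁻¹ := (one_le_inv₀ ha0).2 ha1
    have hw1 : (1 : ℝ) ≤ (w : ℝ) + 1 := by have := Nat.cast_nonneg (α := ℝ) w; linarith
    have hL1 : (1 : ℝ) ≤ (sch.L k : ℝ) + 1 := by have := Nat.cast_nonneg (α := ℝ) (sch.L k); linarith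
    calc (1 : ℝ) = 1 * 1 * 1 := by ring
      _ ≤ _ := by gcongr
  have hXp : 1 ≤ ((sch.a k)⁻¹ * ((w : ℝ) + 1) * ((sch.L k : ℝ) + 1)) ^ ((p₀ + 8) * 2) := one_le_pow₀ hX1
  have hc0 : 0 ≤ 4096 * C₀ * (1 + 2 * Real.exp 2 * |K₀| * (7680 * (t : ℝ) ^ 4)) ^ 2 * Real.exp (4 * κ) := by
    positivity
  have hn0 : 0 ≤ Real.exp (3 * κ) := (Real.exp_pos _).le
  have hE0 : 0 ≤ B ^ 2 * Real.exp (-(κ / t) * sch.a k * Nsep) := by positivity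
  -- near / far, then bookkeeping on opaque atoms
  rcases lt_or_ge Nsep (3 * (t * M ^ n k)) with hnear | hfar
  · have hb := norm_osCorr_le_near r (sch.β k) hκ.le ht0 ha0 hbR hnear hXb
    refine hb.trans ?_
    generalize ((sch.a k)⁻¹ * ((w : ℝ) + 1) * ((sch.L k : ℝ) + 1)) ^ ((p₀ + 8) * 2) = P at hXp ⊢
    generalize Real.exp (-(κ / t) * sch.a k * Nsep) = E at hE0 ⊢
    generalize 4096 * C₀ * (1 + 2 * Real.exp 2 * |K₀| * (7680 * (t : ℝ) ^ 4)) ^ 2 * Real.exp (4 * κ) = Cf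
      at hc0 ⊢
    generalize Real.exp (3 * κ) = Cn at hn0 ⊢
    nlinarith [mul_nonneg hc0 (mul_nonneg (zero_le_one.trans hXp) hE0),
      mul_nonneg hn0 (mul_nonneg (sub_nonneg.2 hXp) hE0)]
  · have hb := norm_osCorr_le_far_poly r hT hκ.le hC₀ hEng (sch.β k) (α k) (hα k) ht ha0 ha1 hbR hb0 hK
      hbL hNw hfar hn₀K hγ hGibbs hphys hPk hXm hXb hXdep
    refine hb.trans ?_
    generalize ((sch.a k)⁻¹ * ((w : ℝ) + 1) * ((sch.L k : ℝ) + 1)) ^ ((p₀ + 8) * 2) = P at hXp ⊢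
    generalize Real.exp (-(κ / t) * sch.a k * Nsep) = E at hE0 ⊢
    generalize 4096 * C₀ * (1 + 2 * Real.exp 2 * |K₀| * (7680 * (t : ℝ) ^ 4)) ^ 2 * Real.exp (4 * κ) = Cf
      at hc0 ⊢
    generalize Real.exp (3 * κ) = Cn at hn0 ⊢
    nlinarith [mul_nonneg hn0 (mul_nonneg (zero_le_one.trans hXp) hE0)]

end

end Summit.QuantumFields.YangMills.Cruxes.LatticeGapOnTrajectory.OrbitKantorovichFiniteSize
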